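import Literature.AlgebraicGeometry.Frobenioids.PerfectionFunctoriality
import Literature.AlgebraicGeometry.Frobenioids.CategoryTheoreticityFacts
import Literature.AlgebraicGeometry.Frobenioids.EquivalenceThm34PerfectAsPrinted
import Literature.AlgebraicGeometry.Frobenioids.EquivalencePreStepsFSMFF2008Assembly
import Literature.AlgebraicGeometry.Frobenioids.Thm49TwinPrimaryWitness
import HarnessLib

/-!
# [FrdI] Theorem 3.4 (iii) and `PreFrobenioid.IsFrobeniusCompatible`: the predicate's universal closure is
# FALSE (kernel witness); its instance form is Theorem 3.4 (iii) — from the typed statement, and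
# unconditionally for Frobenioids of perfect isotropic type

Mochizuki, *The geometry of Frobenioids I: the general theory*, Kyushu J. Math. **62** (2008) 293–400,
Theorem 3.4 (iii), kurims p. 62 [cite: MochizukiFrdI2008, Thm. 3.4 (iii) p.62]: "Suppose that: (a) `C₁`,
`C₂` are of standard type; (b) if `C₁`, `C₂` are of group-like type, then both `Ψ` and some quasi-inverse
to `Ψ` preserve base-isomorphisms. Then `Ψ` preserves morphisms of Frobenius type, … Moreover, there exists
an automorphism of monoids `Ψ^{ℕ≥1}` … such that `Ψ` maps morphisms of Frobenius degree `d` to morphisms of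
Frobenius degree `Ψ^{ℕ≥1}(d)`; if `C₁`, `C₂` admit a non-group-like object, then `Ψ^{ℕ≥1}` is the identity".

PROOF-ONLY file (abc-iut cell, block F fact-proving wave, seat abc-iut-f-002; FACT-LIST row F-2378, the
structure `Literature.AlgebraicGeometry.Frobenioids.PreFrobenioid.IsFrobeniusCompatible F₁ F₂ G` of
`PerfectionFunctoriality.lean`: "`G` carries arrows of Frobenius type to arrows of Frobenius type, of the
same Frobenius degree" — the two hypotheses under which `G^pf : C₁^pf → C₂^pf` is defined). The row is a
PREDICATE on a functor `G`, so its universal closure is not a fact; this file records, kernel-checked: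

* `PreFrobenioid.not_isFrobeniusCompatible_const`, `PreFrobenioid.not_forall_isFrobeniusCompatible` — the
  closure is FALSE even among endofunctors of a genuine Frobenioid: on the elementary Frobenioid of the
  constant monoid `ℚ_{≥0}` over the one-morphism base (abc-iut-w4-d105's `FrdI.T49.Witness.F`, a Frobenioid
  of perfect isotropic type) the CONSTANT functor sends the chosen arrow of Frobenius type of degree `2` to an
  identity, of Frobenius degree `1 ≠ 2`;
* the instance form the row's locator names — Thm. 3.4 (iii): for an EQUIVALENCE `Ψ` between Frobenioids
  of standard type satisfying (b) and admitting non-group-like objects, `Ψ.functor` IS Frobenius-compatible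
  — from the typed per-instance statement `PreFrobenioidData.Thm34iii` (`isFrobeniusCompatible_of_thm34iii_ofFunctor`),
  from the cell's named fact `FrdI.Thm34iii` (FACT-LIST F-0712; `isFrobeniusCompatible_of_thm34iii`, by name),
  and UNCONDITIONALLY for Frobenioids of perfect isotropic type, where the typed Thm. 3.4 (iii) is a kernel
  theorem in the printed generality (abc-iut-w4-d093's `FrdI.thm34iii_ofFunctor_of_isOfPerfectType`):
  `isFrobeniusCompatible_of_isOfPerfectType`. (Over bases of FSM-type / for pre-step-preserving `Ψ` the tree
  already has `FrdI.isFrobeniusCompatible_of_isOfFSMType`, `…_of_preservesPreSteps`.)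

No new definition; no statement of [FrdI] is strengthened or contradicted (the predicate is the paper's
hypothesis-shape, Thm. 3.4 (iii) its theorem); nothing here bears on [IUTchIII] Cor. 3.12.
-/

namespace Literature.AlgebraicGeometry.Frobenioids

namespace PreFrobenioid

open CategoryTheory Opposite

universe w v v' u u'

section Instance

variable {D₁ : Type u} [Category.{v} D₁] {Φ₁ : D₁ᵒᵖ ⥤ CommMonCat.{w}} {C₁ : Type u'} [Category.{v'} C₁]
  {D₂ : Type u} [Category.{v} D₂] {Φ₂ : D₂ᵒᵖ ⥤ CommMonCat.{w}} {C₂ : Type u'} [Category.{v'} C₂]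
  {F₁ : C₁ ⥤ ElemFrobenioid Φ₁} {F₂ : C₂ ⥤ ElemFrobenioid Φ₂}

/-- **Thm. 3.4 (iii) ⟹ Frobenius-compatibility** (instance form of the predicate): if the typed
Thm. 3.4 (iii) holds for `(C₁, C₂, Ψ)`, the `C_i` are of standard type, hypothesis (b) holds, and both sides
admit a non-group-like object, then `Ψ` carries arrows of Frobenius type to arrows of Frobenius type of the
SAME Frobenius degree (`Ψ^{ℕ≥1} = id`). [cite: MochizukiFrdI2008, Thm. 3.4 (iii) p.62] -/
theorem isFrobeniusCompatible_of_thm34iii_ofFunctor (Ψ : C₁ ≌ C₂)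
    (h : (PreFrobenioidData.ofFunctor Φ₁ F₁).Thm34iii (PreFrobenioidData.ofFunctor Φ₂ F₂) Ψ)
    (hs₁ : (PreFrobenioidData.ofFunctor Φ₁ F₁).IsOfStandardType)
    (hs₂ : (PreFrobenioidData.ofFunctor Φ₂ F₂).IsOfStandardType)
    (hB : PreFrobenioidData.HypB (PreFrobenioidData.ofFunctor Φ₁ F₁) (PreFrobenioidData.ofFunctor Φ₂ F₂) Ψ)
    (hN₁ : ∃ A : C₁, ¬ (PreFrobenioidData.ofFunctor Φ₁ F₁).IsGroupLikeObj A)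
    (hN₂ : ∃ A : C₂, ¬ (PreFrobenioidData.ofFunctor Φ₂ F₂).IsGroupLikeObj A) :
    IsFrobeniusCompatible F₁ F₂ Ψ.functor := by
  obtain ⟨⟨hfr, -, -, -, -, -, -⟩, ΨN, hdeg, hΨN⟩ := h hs₁ hs₂ hB
  obtain rfl := hΨN hN₁ hN₂
  refine ⟨fun A B f hf => ?_, fun A B f _ => ?_⟩
  · exact (PreFrobenioidData.ofFunctor_isFrobeniusType F₂ _).mp
      (hfr f ((PreFrobenioidData.ofFunctor_isFrobeniusType F₁ f).mpr hf))
  · simpa only [PreFrobenioidData.ofFunctor_degFr, MulEquiv.refl_apply] using hdeg f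

/-- **The named fact [FrdI] Thm. 3.4 (iii) (`FrdI.Thm34iii`, FACT-LIST F-0712) ⟹ Frobenius-compatibility of
every equivalence between Frobenioids of standard type satisfying (b) with non-group-like objects** — the
instance form of row F-2378 BY NAME of row F-0712. [cite: MochizukiFrdI2008, Thm. 3.4 (iii) p.62] -/
theorem isFrobeniusCompatible_of_thm34iii
    (h : Literature.AlgebraicGeometry.Frobenioids.FrdI.Thm34iii.{w, v, v', u, u'})
    (hF₁ : IsFrobenioid F₁) (hF₂ : IsFrobenioid F₂) (Ψ : C₁ ≌ C₂)
    (hs₁ : (PreFrobenioidData.ofFunctor Φ₁ F₁).IsOfStandardType)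
    (hs₂ : (PreFrobenioidData.ofFunctor Φ₂ F₂).IsOfStandardType)
    (hB : PreFrobenioidData.HypB (PreFrobenioidData.ofFunctor Φ₁ F₁) (PreFrobenioidData.ofFunctor Φ₂ F₂) Ψ)
    (hN₁ : ∃ A : C₁, ¬ (PreFrobenioidData.ofFunctor Φ₁ F₁).IsGroupLikeObj A)
    (hN₂ : ∃ A : C₂, ¬ (PreFrobenioidData.ofFunctor Φ₂ F₂).IsGroupLikeObj A) :
    IsFrobeniusCompatible F₁ F₂ Ψ.functor :=
  isFrobeniusCompatible_of_thm34iii_ofFunctor Ψ (h F₁ F₂ hF₁ hF₂ Ψ) hs₁ hs₂ hB hN₁ hN₂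

/-- **Unconditional instance form, perfect isotropic type**: an equivalence `Ψ` between Frobenioids of
perfect and isotropic type which are of standard type, satisfy (b) and admit non-group-like objects is
Frobenius-compatible — Thm. 3.4 (iii) being a kernel theorem there in the printed generality
(`FrdI.thm34iii_ofFunctor_of_isOfPerfectType`). [cite: MochizukiFrdI2008, Thm. 3.4 (iii) p.62] -/
theorem isFrobeniusCompatible_of_isOfPerfectType (hF₁ : IsFrobenioid F₁) (hF₂ : IsFrobenioid F₂)
    (hist₁ : IsOfIsotropicType F₁) (hist₂ : IsOfIsotropicType F₂) (hperf₁ : IsOfPerfectType F₁)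
    (hperf₂ : IsOfPerfectType F₂) (Ψ : C₁ ≌ C₂)
    (hs₁ : (PreFrobenioidData.ofFunctor Φ₁ F₁).IsOfStandardType)
    (hs₂ : (PreFrobenioidData.ofFunctor Φ₂ F₂).IsOfStandardType)
    (hB : PreFrobenioidData.HypB (PreFrobenioidData.ofFunctor Φ₁ F₁) (PreFrobenioidData.ofFunctor Φ₂ F₂) Ψ)
    (hN₁ : ∃ A : C₁, ¬ (PreFrobenioidData.ofFunctor Φ₁ F₁).IsGroupLikeObj A)
    (hN₂ : ∃ A : C₂, ¬ (PreFrobenioidData.ofFunctor Φ₂ F₂).IsGroupLikeObj A) :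
    IsFrobeniusCompatible F₁ F₂ Ψ.functor :=
  isFrobeniusCompatible_of_thm34iii_ofFunctor Ψ
    (FrdI.thm34iii_ofFunctor_of_isOfPerfectType hF₁ hF₂ hist₁ hist₂ hperf₁ hperf₂ Ψ) hs₁ hs₂ hB hN₁ hN₂

end Instance

/-! ### The universal closure of the predicate is false -/

/-- **Kernel witness against the universal closure of row F-2378**: on the Frobenioid `F_{Φ_{ℚ≥0}} → F_{Φ^char}`
of the constant monoid `ℚ_{≥0}` over the one-morphism base (`FrdI.T49.Witness.F`), the constant endofunctor
at the unique object is NOT Frobenius-compatible: it sends the chosen arrow of Frobenius type of degree `2`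
to the identity, of Frobenius degree `1`. [cite: MochizukiFrdI2008, Thm. 3.4 (iii) p.62] -/
theorem not_isFrobeniusCompatible_const :
    ¬ IsFrobeniusCompatible FrdI.T49.Witness.F FrdI.T49.Witness.F
        ((Functor.const (ElemFrobenioid FrdI.T49.Witness.Φq)).obj FrdI.T49.Witness.A) := by
  intro hG
  have h := hG.degFr_map (frob FrdI.T49.Witness.isFrobenioid FrdI.T49.Witness.A 2)
    (isFrobeniusType_frob FrdI.T49.Witness.isFrobenioid FrdI.T49.Witness.A 2)
  rw [degFr_frob] at h
  change degFr FrdI.T49.Witness.F (𝟙 FrdI.T49.Witness.A) = 2 at h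
  rw [degFr_id] at h
  exact absurd h (by decide)

/-- **The universal closure of FACT-LIST row F-2378 is FALSE**: not every functor between (the underlying
categories of) Frobenioids is Frobenius-compatible — not even every endofunctor of a Frobenioid of perfect
isotropic type (`not_isFrobeniusCompatible_const`). The predicate is admissible only at NAMED instances
(equivalences, via Thm. 3.4 (iii): `isFrobeniusCompatible_of_thm34iii`, `…_of_isOfPerfectType`,
`FrdI.isFrobeniusCompatible_of_isOfFSMType`; identity / composition / unit twists:
`Perfection.isFrobeniusCompatible_id`, `…_comp`, the IUT model instances). [cite: MochizukiFrdI2008, Thm. 3.4 (iii) p.62] -/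
theorem not_forall_isFrobeniusCompatible :
    ¬ ∀ {D : Type} [Category.{0} D] {Φ : Dᵒᵖ ⥤ CommMonCat.{0}} {C : Type} [Category.{0} C]
        (F : C ⥤ ElemFrobenioid Φ) (G : C ⥤ C), IsFrobenioid F → IsFrobeniusCompatible F F G :=
  fun H => not_isFrobeniusCompatible_const (H _ _ FrdI.T49.Witness.isFrobenioid)

/-! ### Printed generality: every equivalence between Frobenioids of standard type is Frobenius-compatible

Appended 2026-08-26 (same seat): the named fact `FrdI.Thm34iii` is now a kernel theorem in the 2008
wording (`FrdI.Thm34iii_holds`, abc-iut-L1-t11, `EquivalencePreStepsFSMFF2008Assembly.lean`), so the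
instance form of row F-2378 holds UNCONDITIONALLY under the printed hypotheses (a), (b) of Thm. 3.4 (iii)
plus non-group-like objects — and with it the perfection square for THE perfections of
`PerfectionFunctoriality.lean`. -/

section Printed

variable {D₁ : Type u} [Category.{v} D₁] {Φ₁ : D₁ᵒᵖ ⥤ CommMonCat.{w}} {C₁ : Type u'} [Category.{v'} C₁]
  {D₂ : Type u} [Category.{v} D₂] {Φ₂ : D₂ᵒᵖ ⥤ CommMonCat.{w}} {C₂ : Type u'} [Category.{v'} C₂]
  {F₁ : C₁ ⥤ ElemFrobenioid Φ₁} {F₂ : C₂ ⥤ ElemFrobenioid Φ₂}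

/-- **[FrdI] Thm. 3.4 (iii), printed generality ⟹ Frobenius-compatibility (UNCONDITIONAL)**: for
Frobenioids `C₁`, `C₂` of standard type such that (b) holds and both admit a non-group-like object, EVERY
equivalence `Ψ : C₁ ≌ C₂` carries arrows of Frobenius type to arrows of Frobenius type of the same Frobenius
degree. This is the hypothesis `hΨ : IsFrobeniusCompatible F₁ F₂ Ψ.functor` of `Perfection.map` and of the
perfection reductions of Thm. 4.2 / Cor. 4.11 (ii) / Thm. 4.9, discharged from (a), (b) and non-group-like
objects alone (by `FrdI.Thm34iii_holds`). [cite: MochizukiFrdI2008, Thm. 3.4 (iii) p.62] -/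
theorem isFrobeniusCompatible_of_isOfStandardType (hF₁ : IsFrobenioid F₁) (hF₂ : IsFrobenioid F₂)
    (Ψ : C₁ ≌ C₂) (hs₁ : (PreFrobenioidData.ofFunctor Φ₁ F₁).IsOfStandardType)
    (hs₂ : (PreFrobenioidData.ofFunctor Φ₂ F₂).IsOfStandardType)
    (hB : PreFrobenioidData.HypB (PreFrobenioidData.ofFunctor Φ₁ F₁) (PreFrobenioidData.ofFunctor Φ₂ F₂) Ψ)
    (hN₁ : ∃ A : C₁, ¬ (PreFrobenioidData.ofFunctor Φ₁ F₁).IsGroupLikeObj A)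
    (hN₂ : ∃ A : C₂, ¬ (PreFrobenioidData.ofFunctor Φ₂ F₂).IsGroupLikeObj A) :
    IsFrobeniusCompatible F₁ F₂ Ψ.functor :=
  isFrobeniusCompatible_of_thm34iii FrdI.Thm34iii_holds hF₁ hF₂ Ψ hs₁ hs₂ hB hN₁ hN₂

/-- **Thm. 3.4 (iii), the perfection square in the printed generality, for THE perfections**
`PreFrobenioid.Perfection hF_i`: `Ψ^pf := Perfection.map` (built on the Frobenius-compatibility just
established) is an EQUIVALENCE of categories. [cite: MochizukiFrdI2008, Thm. 3.4 (iii) p.62] -/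
theorem perfectionMap_isEquivalence_of_isOfStandardType (hF₁ : IsFrobenioid F₁) (hF₂ : IsFrobenioid F₂)
    (Ψ : C₁ ≌ C₂) (hs₁ : (PreFrobenioidData.ofFunctor Φ₁ F₁).IsOfStandardType)
    (hs₂ : (PreFrobenioidData.ofFunctor Φ₂ F₂).IsOfStandardType)
    (hB : PreFrobenioidData.HypB (PreFrobenioidData.ofFunctor Φ₁ F₁) (PreFrobenioidData.ofFunctor Φ₂ F₂) Ψ)
    (hN₁ : ∃ A : C₁, ¬ (PreFrobenioidData.ofFunctor Φ₁ F₁).IsGroupLikeObj A)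
    (hN₂ : ∃ A : C₂, ¬ (PreFrobenioidData.ofFunctor Φ₂ F₂).IsGroupLikeObj A) :
    (Perfection.map (hF₁ := hF₁) (hF₂ := hF₂)
        (isFrobeniusCompatible_of_isOfStandardType hF₁ hF₂ Ψ hs₁ hs₂ hB hN₁ hN₂)).IsEquivalence :=
  Perfection.map_isEquivalence (hF₁ := hF₁) (hF₂ := hF₂) Ψ _

/-- **Thm. 3.4 (iii): "there exists a functor `Ψ^pf : C₁^pf → C₂^pf` that fits into a `1`-commutative
diagram [with `C_i → C_i^pf`] … the horizontal arrows are equivalences of categories"** — printed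
generality, for THE perfections of `PerfectionFunctoriality.lean` (existence, equivalence and
`1`-commutativity; the `1`-uniqueness and rigidity clauses are not treated here).
[cite: MochizukiFrdI2008, Thm. 3.4 (iii) p.62] -/
theorem exists_pfSquare_of_isOfStandardType (hF₁ : IsFrobenioid F₁) (hF₂ : IsFrobenioid F₂)
    (Ψ : C₁ ≌ C₂) (hs₁ : (PreFrobenioidData.ofFunctor Φ₁ F₁).IsOfStandardType)
    (hs₂ : (PreFrobenioidData.ofFunctor Φ₂ F₂).IsOfStandardType)
    (hB : PreFrobenioidData.HypB (PreFrobenioidData.ofFunctor Φ₁ F₁) (PreFrobenioidData.ofFunctor Φ₂ F₂) Ψ)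
    (hN₁ : ∃ A : C₁, ¬ (PreFrobenioidData.ofFunctor Φ₁ F₁).IsGroupLikeObj A)
    (hN₂ : ∃ A : C₂, ¬ (PreFrobenioidData.ofFunctor Φ₂ F₂).IsGroupLikeObj A) :
    ∃ Ψpf : Perfection hF₁ ⥤ Perfection hF₂,
      Ψpf.IsEquivalence ∧ OneCommutes (Perfection.toPf hF₁) Ψpf Ψ.functor (Perfection.toPf hF₂) :=
  ⟨_, perfectionMap_isEquivalence_of_isOfStandardType hF₁ hF₂ Ψ hs₁ hs₂ hB hN₁ hN₂,
    Perfection.oneCommutes_toPf_map (hF₁ := hF₁) (hF₂ := hF₂) _⟩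

end Printed

end PreFrobenioid

end Literature.AlgebraicGeometry.Frobenioids
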